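import Mathlib
import Literature.Analysis.FluidPDE.SereginSverakPressureLocalTypeI
import Literature.Analysis.FluidPDE.SereginSverakPressure
import Literature.Analysis.FluidPDE.TaoEnstrophyLocalisationProofs
import Literature.Analysis.FluidPDE.TaoEnstrophyLocalisation
import Literature.Analysis.FluidPDE.PineauVicolOneSliceProofs
import Literature.Analysis.FluidPDE.KNSSTypeIIHolds
import HarnessLib

/-!
# `StretchingWellBinding.TypeIBridge` — tools (item stmt-NavierStokesRegularity-10521, part 1 of 2)

Two inputs of the proof of `TypeIBridge` (enstrophy Type I at a maximal time yields a local
Type-I singular point), see `StretchingWellBindingTypeIBridge.lean`: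

* `TypeIBridge.exists_not_isBackwardBoundedAt` — a MAXIMAL classical Leray–Hopf solution is not
  backward bounded at some final-time point (near-field compactness + far-field bound + continuation
  of bounded solutions, RRS 2016 Thm. 8.17, after an energy-good restart);
* `TypeIBridge.cknE_le_of_slice_bound_at` — slice bounds `∫_{B(x,r)} |G(t)|² ≤ K/√(t₀ − t)` on
  `(t₀ − r², t₀)` give the scaled dissipation bound `E(Q((t₀,x), r)) ≤ 2K` at ANY centre (the
  tree's `cknE_le_of_slice_bound` is the case of the origin; the time integral
  `∫_{t₀−r²}^{t₀} (t₀ − t)^{-1/2} dt = 2r` is translated).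

HONEST FRAMING: elementary tools about HYPOTHETICAL objects; nothing here bears on the regularity
problem itself.
-/

noncomputable section

set_option linter.dupNamespace false

namespace Summit.NavierStokesRegularity.NavierStokesRegularity.Theorems

open MeasureTheory Set Filter Topology Metric Function Literature.Analysis.FluidPDE
open scoped NNReal ENNReal

namespace TypeIBridge

variable {ν T : ℝ} {u : ℝ → (EuclideanSpace ℝ (Fin 3)) → (EuclideanSpace ℝ (Fin 3))} {p : ℝ → (EuclideanSpace ℝ (Fin 3)) → ℝ}

/-! ### Step 1: a maximal solution has a point that is not backward bounded -/

/-- **A maximal classical Leray–Hopf solution is not backward bounded at some final-time point**: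
otherwise near-field compactness and the far-field bound make `u` bounded on `(δ, T) × ℝ³`, and a
bounded classical Leray–Hopf solution continues past `T` (restart at an energy-good time; RRS 2016
Thm. 8.17). [cite: RobinsonRodrigoSadowski2016, Thm. 8.17] -/
theorem exists_not_isBackwardBoundedAt (hν : 0 < ν) (hT : 0 < T)
    (hmax : IsMaximalSmoothSolution ν 0 u p T) (hLH : IsLerayHopfOn T ν 0 (u 0) u) :
    ∃ x₀ : (EuclideanSpace ℝ (Fin 3)), ¬ IsBackwardBoundedAt u T x₀ := by
  by_contra hno
  push Not at hno
  have hsol : IsClassicalNSSolutionOn (Ico 0 T) ν 0 u p := hmax.1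
  -- `u` is bounded on `(δ, T) × ℝ³` for every `δ ∈ (0, T)`
  have hbd : ∀ δ ∈ Ioo 0 T, ∃ M : ℝ, ∀ t ∈ Ioo δ T, ∀ x, ‖u t x‖ ≤ M := by
    intro δ hδ
    obtain ⟨R, M₁, hfar⟩ := SereginSverak2002.farField_bound hν hT hsol hLH hδ.1
    obtain ⟨M₂, hnear⟩ := SereginSverak2002.nearField_bound hT
      (SereginSverak2002.continuousOn_uncurry hsol) hno hδ.1 R
    refine ⟨max M₁ M₂, fun t ht x => ?_⟩
    by_cases hx : ‖x‖ ≤ R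
    · exact (hnear (t, x) ⟨⟨ht.1.le, ht.2.le⟩, mem_closedBall_zero_iff.2 hx⟩ ht.2).trans
        (le_max_right _ _)
    · exact (hfar t ht x (not_le.1 hx)).trans (le_max_left _ _)
  -- restart at an energy-good time and continue the bounded translate past `T`
  obtain ⟨s, hs, hLHs⟩ := hLH.exists_isLerayHopfOn_translate hsol hν.le hT le_rfl
  have hs2 : s / 2 ∈ Ioo 0 T := ⟨by linarith [hs.1], by linarith [hs.2]⟩
  obtain ⟨M, hM⟩ := hbd (s / 2) hs2
  have hsol' : IsClassicalNSSolutionOn (Ico 0 (T - s)) ν 0 (fun t => u (t + s))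
      (fun t => p (t + s)) := hsol.translate_Ico_zero hs.1.le
  have hLHs' : IsLerayHopfOn (T - s) ν 0 ((fun t => u (t + s)) 0) (fun t => u (t + s)) := by
    show IsLerayHopfOn (T - s) ν 0 (u (0 + s)) (fun t => u (t + s))
    rw [zero_add]
    exact hLHs
  have hMs : ∃ M : ℝ, ∀ t ∈ Ico 0 (T - s), ∀ x, ‖(fun t => u (t + s)) t x‖ ≤ M :=
    ⟨M, fun t ht x => hM (t + s) ⟨by linarith [ht.1, hs.1], by linarith [ht.2]⟩ x⟩
  have hext : HasSmoothExtensionPast ν 0 (fun t => u (t + s)) (T - s) :=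
    hasSmoothExtensionPast_of_bounded_holds hν (sub_pos.2 hs.2) hsol' hLHs' hMs
  exact hmax.2 (HasSmoothExtensionPast.of_translate hsol hs.1 hs.2 hext)

/-! ### Step 3 tools: slice bounds give scaled-dissipation bounds on any parabolic ball -/

/-- `∫⁻_{(s₀ − r², s₀)} K/√(s₀ − t) dt = 2Kr` (translate of the tree's
`lintegral_Ioo_const_div_sqrt_neg`). [folklore] -/
theorem lintegral_Ioo_const_div_sqrt_sub (s₀ : ℝ) {r K : ℝ} (hr : 0 ≤ r) (hK : 0 ≤ K) :
    ∫⁻ t in Ioo (s₀ - r ^ 2) s₀, ENNReal.ofReal (K / Real.sqrt (s₀ - t)) =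
      ENNReal.ofReal (2 * K * r) := by
  rw [← lintegral_Ioo_const_div_sqrt_neg hr hK]
  set f : ℝ → ℝ≥0∞ := fun τ => ENNReal.ofReal (K / Real.sqrt (-τ)) with hf
  have hpre : Ioo (s₀ - r ^ 2) s₀ = (fun t => t - s₀) ⁻¹' Ioo (-r ^ 2) 0 := by
    ext t; simp only [mem_Ioo, mem_preimage]; constructor <;> rintro ⟨h1, h2⟩ <;>
      constructor <;> linarith
  have h1 : ∫⁻ t in Ioo (s₀ - r ^ 2) s₀, ENNReal.ofReal (K / Real.sqrt (s₀ - t)) =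
      ∫⁻ t, (Ioo (-r ^ 2) (0 : ℝ)).indicator f (t - s₀) := by
    rw [← lintegral_indicator measurableSet_Ioo]
    refine lintegral_congr fun t => ?_
    have e : (Ioo (-r ^ 2) (0 : ℝ)).indicator f (t - s₀) =
        ((fun t => t - s₀) ⁻¹' Ioo (-r ^ 2) 0).indicator (f ∘ fun t => t - s₀) t :=
      (indicator_comp_right (fun t : ℝ => t - s₀) (s := Ioo (-r ^ 2) (0 : ℝ)) (g := f)
        (x := t)).symm
    rw [e, ← hpre]
    by_cases ht : t ∈ Ioo (s₀ - r ^ 2) s₀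
    · rw [indicator_of_mem ht, indicator_of_mem ht]
      simp only [Function.comp, hf, neg_sub]
    · rw [indicator_of_notMem ht, indicator_of_notMem ht]
  rw [h1, lintegral_sub_right_eq_self (fun t => (Ioo (-r ^ 2) (0 : ℝ)).indicator f t) s₀,
    lintegral_indicator measurableSet_Ioo]

/-- **Scaled dissipation from slice bounds, any centre**: if a gradient field `G` has
`∫_{B(z.2, r)} |G(t,·)|² ≤ K / √(z.1 − t)` for `t ∈ (z.1 − r², z.1)` (and its density is a.e.
measurable on the cylinder), then `E(Q(z, r)) = r⁻¹ ∫∫_{Q(z,r)} |G|² ≤ 2K`.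
[cite: PineauVicol2026, proof of Prop. 9.5, (9.15)–(9.16)] -/
theorem cknE_le_of_slice_bound_at (z : ℝ × (EuclideanSpace ℝ (Fin 3))) {G : ℝ → (EuclideanSpace ℝ (Fin 3)) → (EuclideanSpace ℝ (Fin 3)) →L[ℝ] (EuclideanSpace ℝ (Fin 3))} {r K : ℝ}
    (hr : 0 < r) (hK : 0 ≤ K)
    (hG : AEMeasurable (fun w : ℝ × (EuclideanSpace ℝ (Fin 3)) => ENNReal.ofReal (frobeniusNormSq (G w.1 w.2)))
      (volume.restrict (parabolicCylinder r z)))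
    (hslice : ∀ t ∈ Ioo (z.1 - r ^ 2) z.1,
      ∫⁻ x in ball z.2 r, ENNReal.ofReal (frobeniusNormSq (G t x)) ≤
        ENNReal.ofReal (K / Real.sqrt (z.1 - t))) :
    cknE r z G ≤ ENNReal.ofReal (2 * K) := by
  set F : ℝ × (EuclideanSpace ℝ (Fin 3)) → ℝ≥0∞ := fun w => ENNReal.ofReal (frobeniusNormSq (G w.1 w.2)) with hF
  have hset : parabolicCylinder r z = Ioo (z.1 - r ^ 2) z.1 ×ˢ ball z.2 r := rfl
  have hμ : (volume.restrict (parabolicCylinder r z) : Measure (ℝ × (EuclideanSpace ℝ (Fin 3)))) =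
      (volume.restrict (Ioo (z.1 - r ^ 2) z.1)).prod (volume.restrict (ball z.2 r)) := by
    rw [hset, Measure.volume_eq_prod, Measure.prod_restrict]
  have hint : ∫⁻ w in parabolicCylinder r z, F w ≤ ENNReal.ofReal (2 * K * r) := by
    rw [hμ] at hG ⊢
    rw [lintegral_prod _ hG, ← lintegral_Ioo_const_div_sqrt_sub z.1 hr.le hK]
    exact setLIntegral_mono_ae' measurableSet_Ioo (ae_of_all _ fun t ht => hslice t ht)
  have hr0 : ENNReal.ofReal r ≠ 0 := by simpa using hr
  unfold cknE
  calc (ENNReal.ofReal r)⁻¹ * ∫⁻ w in parabolicCylinder r z, F w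
      ≤ (ENNReal.ofReal r)⁻¹ * ENNReal.ofReal (2 * K * r) := by gcongr
    _ = ENNReal.ofReal (2 * K) := by
        rw [show 2 * K * r = r * (2 * K) by ring, ENNReal.ofReal_mul hr.le, ← mul_assoc,
          ENNReal.inv_mul_cancel hr0 ENNReal.ofReal_ne_top, one_mul]

end TypeIBridge

end Summit.NavierStokesRegularity.NavierStokesRegularity.Theorems

end
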